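import Mathlib.Analysis.Complex.JensenFormula
import Literature.Analysis.Complex.LogDerivZerosDisc
import Literature.NumberTheory.LFunctions.DedekindZetaEntireConvexity
import HarnessLib

/-!
# `ζ_K'/ζ_K` near the critical line under GRH, uniformly in the number field

Topic `Literature/NumberTheory/LFunctions` (namespace `Literature.NumberTheory.LFunctions`,
continuing `DedekindZetaEntireConvexity.lean`). Everything in this file is PROVED; there are no named
facts. The only hypothesis is the Extended Riemann Hypothesis for the field `K`
(`NumberField.ExtendedRiemannHypothesis K`, an open conjecture, taken as an explicit assumption).

For a number field `K` (`n_K = [K : ℚ]`, discriminant `d_K`) and the entire function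
`ζ₁_K(s) = (s − 1)ζ_K(s)` (`dedekindZeta₁ K`) we prove, with ABSOLUTE numerical constants,

* `finsum_divisor_dedekindZeta₁_le` — **Jensen's inequality** (Mathlib's
  `AnalyticOnNhd.sum_divisor_le`): the number of zeros of `ζ_K` in the disc `|s − (2 + it)| ≤ r`
  (`0 < r < 2`), with multiplicity, is at most `M_K(t)/log(2/r)`, where
  `M_K(t) = log|d_K| + 3 n_K + (n_K + 1) log(|t| + 7)` (`discBound K t`) dominates
  `log( sup_{|s−(2+it)|≤2} |ζ₁_K| / |ζ₁_K(2 + it)| )` by the convexity bound and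
  `|ζ₁_K(2+it)| ≥ e^{−n_K}` of `DedekindZetaEntireConvexity.lean`. This is Lagarias–Odlyzko 1977,
  Lemma 5.4 ("`n_L(t; 1) ≪ log d_L + n_L log(|t| + 2)`"), in disc form;
* `norm_logDeriv_dedekindZeta₁_le_of_erh` — **under ERH for `K`**: for `0 < η ≤ 1/4`, real `t`,
  and `s` with `|s − (2 + it)| ≤ 3/2`, `Re s ≥ 1/2 + η`,
  `|ζ₁_K'/ζ₁_K(s)| ≤ 3024 · M_K(t)/η`.
  Proof: Landau's local lemma (Titchmarsh §3.9 Lemma α, the tree's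
  `Literature.Analysis.Complex.norm_logDeriv_sub_sum_le`, radii `3/2 < 13/8 < 7/4 < 2`) gives
  `ζ₁'/ζ₁(s) = ∑_ρ m(ρ)/(s − ρ) + O(M_K(t))` over the zeros `ρ` in `|ρ − (2+it)| ≤ 7/4`; under ERH
  these have `Re ρ = 1/2` (they lie in `0 < Re ρ < 1` by the non-vanishing on `Re s ≥ 1`), so
  `|s − ρ| ≥ η`, and their number is `≤ 8 M_K(t)` (Jensen). Compare Lagarias–Odlyzko 1977,
  Lemma 5.6 and §6 (there without ERH, with the sum over zeros kept).

These feed the GRH-conditional Chebyshev bound for `ψ_K` (`GRHChebyshevPsiLowerBound.lean`) behind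
Bürgisser 2000 TCS, Thm. 4.1.

## References

* J. C. Lagarias, A. M. Odlyzko, *Effective versions of the Chebotarev density theorem* (1977),
  §5, Lemmas 5.4–5.6 (`LagariasOdlyzko1977`).
* E. C. Titchmarsh, *The Theory of the Riemann Zeta-Function*, 2nd ed. (1986), §3.9 Lemma α
  (`Titchmarsh1986`).
-/

noncomputable section

open Complex Filter Topology Set Metric MeromorphicOn NumberField
open scoped NumberField

namespace Literature.NumberTheory.LFunctions

variable (K : Type*) [Field K] [NumberField K]

/-! ### The disc bound `M_K(t)` -/

/-- `M_K(t) = log|d_K| + 3 n_K + (n_K + 1) log(|t| + 7)`: a bound for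
`log( sup_{|s − (2+it)| ≤ 2} |ζ₁_K(s)| / |ζ₁_K(2+it)| )` (Lagarias–Odlyzko's `log d_L + n_L log(|t|+2)`
up to constants). [cite: LagariasOdlyzko1977, Lemma 5.4] -/
def discBound (t : ℝ) : ℝ :=
  Real.log ((discr K).natAbs : ℝ) + 3 * Module.finrank ℚ K + (Module.finrank ℚ K + 1) * Real.log (|t| + 7)

/-- `log(|t| + 7) ≥ 1`. [folklore] -/
theorem one_le_log_abs_add_seven (t : ℝ) : 1 ≤ Real.log (|t| + 7) := by
  rw [← Real.log_exp 1]
  refine Real.log_le_log (Real.exp_pos 1) ?_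
  have := Real.exp_one_lt_d9
  linarith [abs_nonneg t]

/-- `M_K(t) ≥ 1` (indeed `≥ 5`). [folklore] -/
theorem one_le_discBound (t : ℝ) : 1 ≤ discBound K t := by
  unfold discBound
  have h1 : 0 ≤ Real.log ((discr K).natAbs : ℝ) := Real.log_natCast_nonneg _
  have h2 : (1 : ℝ) ≤ Module.finrank ℚ K := by exact_mod_cast Module.finrank_pos (R := ℚ) (M := K)
  have h3 := one_le_log_abs_add_seven t
  nlinarith

/-- `M_K(t) ≥ 0`. [folklore] -/
theorem discBound_nonneg (t : ℝ) : 0 ≤ discBound K t := zero_le_one.trans (one_le_discBound K t)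

/-- The Jensen quotient is dominated by `M_K(t)`:
`log( |d_K| e^{2n_K} (|t|+7)^{n_K+1} / |ζ₁_K(2+it)| ) ≤ M_K(t)` (`|ζ₁_K(2+it)| ≥ e^{−n_K}`).
[folklore] -/
theorem log_discSup_div_norm_le (t : ℝ) :
    Real.log (((discr K).natAbs : ℝ) * Real.exp (2 * Module.finrank ℚ K) *
        (|t| + 7) ^ (Module.finrank ℚ K + 1) / ‖dedekindZeta₁ K (2 + t * I)‖) ≤ discBound K t := by
  set n : ℕ := Module.finrank ℚ K with hn
  have hd : (0 : ℝ) < ((discr K).natAbs : ℝ) := by exact_mod_cast Int.natAbs_pos.mpr (discr_ne_zero K)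
  have ht : (0 : ℝ) < |t| + 7 := by linarith [abs_nonneg t]
  have hf0 : 0 < Real.exp (-(n : ℝ)) := Real.exp_pos _
  have hf : Real.exp (-(n : ℝ)) ≤ ‖dedekindZeta₁ K (2 + t * I)‖ :=
    exp_neg_finrank_le_norm_dedekindZeta₁_two_add K t
  have hfpos : 0 < ‖dedekindZeta₁ K (2 + t * I)‖ := hf0.trans_le hf
  rw [Real.log_div (by positivity) hfpos.ne', Real.log_mul (by positivity) (by positivity),
    Real.log_mul hd.ne' (by positivity), Real.log_exp, Real.log_pow]
  have hlogf : -(n : ℝ) ≤ Real.log ‖dedekindZeta₁ K (2 + t * I)‖ := by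
    rw [← Real.log_exp (-(n : ℝ))]
    exact Real.log_le_log hf0 hf
  unfold discBound
  push_cast
  linarith

/-! ### Jensen's inequality for `ζ₁_K` -/

/-- **Zeros of `ζ_K` in a disc at height `t`** (Jensen's inequality; Lagarias–Odlyzko 1977, Lemma 5.4
in disc form): for `0 < r < 2`, the number of zeros of `ζ₁_K` (equivalently of `ζ_K`) in
`|s − (2 + it)| ≤ r`, counted with multiplicity (Mathlib's `divisor`), is at most `M_K(t)/log(2/r)`.
[cite: LagariasOdlyzko1977, Lemma 5.4] -/
theorem finsum_divisor_dedekindZeta₁_le (t : ℝ) {r : ℝ} (hr : 0 < r) (hr' : r < 2) :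
    (∑ᶠ u, divisor (dedekindZeta₁ K) (closedBall (2 + t * I) r) u : ℝ) ≤
      discBound K t / Real.log (2 / r) := by
  set c : ℂ := 2 + t * I with hc
  set B : ℝ := ((discr K).natAbs : ℝ) * Real.exp (2 * Module.finrank ℚ K) *
    (|t| + 7) ^ (Module.finrank ℚ K + 1) with hB
  have hd1 : (1 : ℝ) ≤ ((discr K).natAbs : ℝ) := by exact_mod_cast Int.natAbs_pos.mpr (discr_ne_zero K)
  have hB1 : 1 ≤ B := by
    rw [hB]
    have h1 : (1 : ℝ) ≤ Real.exp (2 * Module.finrank ℚ K) := Real.one_le_exp (by positivity)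
    have h2 : (1 : ℝ) ≤ (|t| + 7) ^ (Module.finrank ℚ K + 1) := one_le_pow₀ (by linarith [abs_nonneg t])
    calc (1 : ℝ) = 1 * 1 * 1 := by ring
      _ ≤ _ := by gcongr
  have hc0 : dedekindZeta₁ K c ≠ 0 := dedekindZeta₁_ne_zero_of_one_le_re (by simp [hc])
  have h1 : 0 < |r| := by rwa [abs_of_pos hr]
  have h2 : |r| < |(2 : ℝ)| := by rw [abs_of_pos hr, abs_of_pos two_pos]; exact hr'
  have h3 : AnalyticOnNhd ℂ (dedekindZeta₁ K) (closedBall c |(2 : ℝ)|) := analyticOnNhd_dedekindZeta₁ K _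
  have h4 : ∀ z ∈ sphere c |(2 : ℝ)|, ‖dedekindZeta₁ K z‖ ≤ B := by
    intro z hz
    rw [abs_of_pos two_pos] at hz
    exact norm_dedekindZeta₁_le_of_mem_closedBall K t (sphere_subset_closedBall hz)
  have hJ := AnalyticOnNhd.sum_divisor_le h1 h2 hB1 h3 hc0 h4
  rw [abs_of_pos hr] at hJ
  have hcast : ((∑ᶠ u, divisor (dedekindZeta₁ K) (closedBall c r) u : ℤ) : ℝ) =
      ∑ᶠ u, (divisor (dedekindZeta₁ K) (closedBall c r) u : ℝ) :=
    map_finsum (Int.castRingHom ℝ)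
      ((divisor (dedekindZeta₁ K) (closedBall c r)).finiteSupport (isCompact_closedBall _ _))
  rw [← hcast]
  refine hJ.trans (div_le_div_of_nonneg_right (log_discSup_div_norm_le K t) (Real.log_nonneg ?_))
  rw [le_div_iff₀ hr]; linarith

/-- The Jensen count of the disc `|s − (2 + it)| ≤ 7/4`, as a sum over the support of the divisor:
`∑_ρ m(ρ) ≤ 8 M_K(t)` (`log(8/7) ≥ 1/8`). [cite: LagariasOdlyzko1977, Lemma 5.4] -/
theorem sum_divisor_dedekindZeta₁_le (t : ℝ) :
    ∑ u ∈ ((divisor (dedekindZeta₁ K) (closedBall (2 + t * I) (7 / 4))).finiteSupport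
        (isCompact_closedBall _ _)).toFinset,
      (divisor (dedekindZeta₁ K) (closedBall (2 + t * I) (7 / 4)) u : ℝ) ≤ 8 * discBound K t := by
  set D := divisor (dedekindZeta₁ K) (closedBall (2 + t * I) (7 / 4)) with hD
  have hfin : (Function.support D).Finite := D.finiteSupport (isCompact_closedBall _ _)
  have hsum : ∑ u ∈ hfin.toFinset, (D u : ℝ) = ∑ᶠ u, (D u : ℝ) := by
    rw [finsum_eq_sum_of_support_subset (fun u => (D u : ℝ)) (s := hfin.toFinset) ?_]
    intro u hu
    simp only [Function.mem_support, ne_eq, Int.cast_eq_zero] at hu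
    simpa using hu
  rw [hsum]
  have hJ := finsum_divisor_dedekindZeta₁_le K t (r := 7 / 4) (by norm_num) (by norm_num)
  refine hJ.trans ?_
  have hlog : 1 / 8 ≤ Real.log (2 / (7 / 4)) := by
    have := Real.one_sub_inv_le_log_of_pos (x := 2 / (7 / 4)) (by norm_num)
    norm_num at this ⊢
    linarith
  have hM := discBound_nonneg K t
  rw [div_le_iff₀ (by linarith)]
  nlinarith

/-! ### The zeros in the disc under ERH -/

variable {K} in
/-- Under ERH for `K`, a zero of `ζ₁_K` with `Re ρ > 0` has `Re ρ = 1/2` (zeros of `ζ₁_K` are zeros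
of `ζ_K` off `1`; there are none on `Re s ≥ 1`). [folklore] -/
theorem re_eq_one_half_of_erh (hERH : NumberField.ExtendedRiemannHypothesis K) {ρ : ℂ}
    (hρ : dedekindZeta₁ K ρ = 0) (hρ0 : 0 < ρ.re) : ρ.re = 1 / 2 := by
  obtain ⟨hρ1, hζ⟩ := dedekindZetaCont_eq_zero_of_dedekindZeta₁_eq_zero hρ
  have hlt : ρ.re < 1 := by
    by_contra h
    exact dedekindZetaCont_ne_zero_of_one_le_re_holds K (not_lt.mp h) hρ1 hζ
  exact hERH ρ hζ hρ0 hlt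

variable {K} in
/-- Under ERH for `K`: `ζ₁_K(s) ≠ 0` for `Re s > 1/2`. [folklore] -/
theorem dedekindZeta₁_ne_zero_of_erh (hERH : NumberField.ExtendedRiemannHypothesis K) {s : ℂ}
    (hs : 1 / 2 < s.re) : dedekindZeta₁ K s ≠ 0 := fun h ↦ by
  have := re_eq_one_half_of_erh hERH h (by linarith)
  linarith

/-! ### The logarithmic derivative under ERH -/

/-- **`ζ₁_K'/ζ₁_K` near the critical line under ERH** (cf. Lagarias–Odlyzko 1977, Lemma 5.6 and
§6): assume ERH for `K`; let `0 < η ≤ 1/4`, `t ∈ ℝ`, and `|s − (2 + it)| ≤ 3/2`, `Re s ≥ 1/2 + η`.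
Then `|ζ₁_K'/ζ₁_K(s)| ≤ 3024 · M_K(t)/η`, `M_K(t) = log|d_K| + 3n_K + (n_K+1) log(|t|+7)`.
(Landau's lemma `norm_logDeriv_sub_sum_le` with radii `3/2, 13/8, 7/4, 2`: the `≤ 8 M_K(t)`
zeros `ρ` in `|ρ − (2+it)| ≤ 7/4` have `Re ρ = 1/2`, so `|s − ρ| ≥ η`.)
[cite: LagariasOdlyzko1977, Lemma 5.6] -/
theorem norm_logDeriv_dedekindZeta₁_le_of_erh (hERH : NumberField.ExtendedRiemannHypothesis K)
    {η : ℝ} (hη0 : 0 < η) (hη : η ≤ 1 / 4) (t : ℝ) {s : ℂ}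
    (hs : s ∈ closedBall (2 + t * I) (3 / 2)) (hsre : 1 / 2 + η ≤ s.re) :
    ‖logDeriv (dedekindZeta₁ K) s‖ ≤ 3024 * discBound K t / η := by
  classical
  set f := dedekindZeta₁ K with hf
  set c : ℂ := 2 + t * I with hc
  set B : ℝ := ((discr K).natAbs : ℝ) * Real.exp (2 * Module.finrank ℚ K) *
    (|t| + 7) ^ (Module.finrank ℚ K + 1) with hB
  set M : ℝ := discBound K t with hM
  have hM1 : 1 ≤ M := one_le_discBound K t
  have hfs : f s ≠ 0 := dedekindZeta₁_ne_zero_of_erh hERH (by linarith)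
  have hc0 : f c ≠ 0 := dedekindZeta₁_ne_zero_of_one_le_re (by simp [hc])
  -- Landau's local lemma
  have h := Literature.Analysis.Complex.norm_logDeriv_sub_sum_le (f := f) (c := c)
    (r := 3 / 2) (r₁ := 13 / 8) (R₂ := 7 / 4) (R := 2) (B := B)
    (by norm_num) (by norm_num) (by norm_num) (by norm_num)
    (analyticOnNhd_dedekindZeta₁ K _) hc0
    (fun z hz ↦ norm_dedekindZeta₁_le_of_mem_closedBall K t hz) hs hfs
  set D := divisor f (closedBall c (7 / 4)) with hD
  set S := (D.finiteSupport (isCompact_closedBall c (7 / 4))).toFinset with hS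
  set N : ℝ := ∑ u ∈ S, (D u : ℝ) with hN
  have hN8 : N ≤ 8 * M := sum_divisor_dedekindZeta₁_le K t
  have hD0 : ∀ u, 0 ≤ D u := fun u ↦ (analyticOnNhd_dedekindZeta₁ K (closedBall c (7 / 4))).divisor_nonneg u
  have hN0 : 0 ≤ N := Finset.sum_nonneg fun u _ ↦ by exact_mod_cast hD0 u
  -- the zeros in the disc lie on the critical line, at distance `≥ η` from `s`
  have hdist : ∀ u ∈ S, η ≤ ‖s - u‖ := by
    intro u hu
    rw [hS, Set.Finite.mem_toFinset, Function.mem_support] at hu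
    have huB : u ∈ closedBall c (7 / 4) := D.supportWithinDomain (Function.mem_support.2 hu)
    have hfu : f u = 0 := by
      have han := analyticOnNhd_dedekindZeta₁ K (closedBall c (7 / 4))
      rw [hD, divisor_apply han.meromorphicOn huB,
        ((dedekindZeta₁_differentiable K).analyticAt u).meromorphicOrderAt_eq] at hu
      by_contra hne
      apply hu
      rw [((dedekindZeta₁_differentiable K).analyticAt u).analyticOrderAt_eq_zero.2 hne]
      simp
    have hure0 : 0 < u.re := by
      rw [mem_closedBall, dist_eq_norm] at huB
      have := abs_re_le_norm (u - c)
      simp only [hc, sub_re, add_re, re_ofNat, mul_re, ofReal_re, I_re, mul_zero, ofReal_im, I_im,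
        mul_one, sub_self, add_zero] at this
      have := (abs_le.mp (this.trans huB)).1
      linarith
    have hure : u.re = 1 / 2 := re_eq_one_half_of_erh hERH hfu hure0
    calc η ≤ |(s - u).re| := by rw [sub_re, hure, abs_of_nonneg (by linarith)]; linarith
      _ ≤ ‖s - u‖ := abs_re_le_norm _
  -- the sum over the zeros
  have hsum : ‖∑ u ∈ S, (D u : ℂ) / (s - u)‖ ≤ N / η := by
    calc ‖∑ u ∈ S, (D u : ℂ) / (s - u)‖ ≤ ∑ u ∈ S, ‖(D u : ℂ) / (s - u)‖ := norm_sum_le _ _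
      _ ≤ ∑ u ∈ S, (D u : ℝ) / η := by
          refine Finset.sum_le_sum fun u hu ↦ ?_
          rw [norm_div, Complex.norm_intCast, abs_of_nonneg (by exact_mod_cast hD0 u)]
          by_cases hDu : (D u : ℝ) = 0
          · rw [hDu, zero_div, zero_div]
          · exact div_le_div_of_nonneg_left (by exact_mod_cast hD0 u) hη0 (hdist u hu)
      _ = N / η := by rw [hN, Finset.sum_div]
  -- the remainder
  have hlog8 : Real.log (2 / (2 - 7 / 4)) ≤ 7 := by
    have := Real.log_le_sub_one_of_pos (x := 2 / (2 - 7 / 4)) (by norm_num)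
    norm_num at this ⊢
    linarith
  have hlogB : Real.log (B / ‖f c‖) ≤ M := log_discSup_div_norm_le K t
  have hrem : 2 * (13 / 8 : ℝ) / ((7 / 4 - 13 / 8) * (13 / 8 - 3 / 2)) *
      (Real.log (B / ‖f c‖) + N * Real.log (2 / (2 - 7 / 4)) + 1) ≤ 208 * (58 * M) := by
    have hK : 2 * (13 / 8 : ℝ) / ((7 / 4 - 13 / 8) * (13 / 8 - 3 / 2)) = 208 := by norm_num
    rw [hK]
    refine mul_le_mul_of_nonneg_left ?_ (by norm_num)
    have : N * Real.log (2 / (2 - 7 / 4)) ≤ 8 * M * 7 :=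
      mul_le_mul hN8 hlog8 (Real.log_nonneg (by norm_num)) (by positivity)
    linarith
  -- assemble
  have htri : ‖logDeriv f s‖ ≤ ‖∑ u ∈ S, (D u : ℂ) / (s - u)‖ +
      ‖logDeriv f s - ∑ u ∈ S, (D u : ℂ) / (s - u)‖ := by
    have := norm_add_le (∑ u ∈ S, (D u : ℂ) / (s - u)) (logDeriv f s - ∑ u ∈ S, (D u : ℂ) / (s - u))
    rwa [add_sub_cancel] at this
  have hη4 : 4 ≤ 1 / η := by rw [le_div_iff₀ hη0]; linarith
  calc ‖logDeriv f s‖ ≤ N / η + 208 * (58 * M) := htri.trans (add_le_add hsum (h.trans hrem))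
    _ ≤ 8 * M / η + 12064 * M := by
        have : N / η ≤ 8 * M / η := div_le_div_of_nonneg_right hN8 hη0.le
        linarith
    _ ≤ 8 * M / η + 12064 * M * (1 / η * (1 / 4)) := by
        have h1 : (1 : ℝ) ≤ 1 / η * (1 / 4) := by nlinarith
        have hpos : 0 ≤ 12064 * M := by positivity
        nlinarith
    _ = 3024 * M / η := by ring

/-- The same bound on the vertical line `Re s = 1/2 + η` and to its right, for all heights:
under ERH for `K`, for `0 < η ≤ 1/4` and `1/2 + η ≤ Re s ≤ 2`,
`|ζ₁_K'/ζ₁_K(s)| ≤ 3024 M_K(Im s)/η`. [cite: LagariasOdlyzko1977, Lemma 5.6] -/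
theorem norm_logDeriv_dedekindZeta₁_le_of_erh' (hERH : NumberField.ExtendedRiemannHypothesis K)
    {η : ℝ} (hη0 : 0 < η) (hη : η ≤ 1 / 4) {s : ℂ} (hs₁ : 1 / 2 + η ≤ s.re) (hs₂ : s.re ≤ 2) :
    ‖logDeriv (dedekindZeta₁ K) s‖ ≤ 3024 * discBound K s.im / η := by
  refine norm_logDeriv_dedekindZeta₁_le_of_erh K hERH hη0 hη s.im ?_ hs₁
  rw [mem_closedBall, dist_eq_norm, show s - (2 + (s.im : ℂ) * I) = ((s.re - 2 : ℝ) : ℂ) by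
    apply Complex.ext <;> simp]
  rw [norm_real, Real.norm_eq_abs, abs_le]
  constructor <;> linarith

end Literature.NumberTheory.LFunctions

end
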